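import Literature.NumberTheory.LFunctions.MoebiusWalshCircuitsFourierWalshProofs
import Literature.NumberTheory.LFunctions.MoebiusWalshCircuitsACdProofs
import HarnessLib

/-!
# Liouville–Walsh sums of small weight (Bourgain 2013, (2.32), for `λ`) — proved

Topic `Literature/NumberTheory/LFunctions`, proofs companion of `MoebiusWalshCircuits.lean`
(named fact `bourgain_liouville_walsh_uniform`: J. Bourgain, *Möbius–Walsh correlation bounds and
an estimate of Mauduit and Rivat*, J. Anal. Math. 119 (2013) 147–163 = arXiv:1109.2784,
Theorem 1 and its Liouville parenthesis). Everything here is PROVED (theorems only; no definition,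
no named fact).

Bourgain, §2, (2.32): "For `|S| ≤ λ^{1/2}/H` with `H ≫ 1` a parameter, we apply B. Green's estimate
(see [Gr]) `|∑_{x<2^λ} w_S(x) μ(x)| < λ e^{-cH}` [`·2^λ`]. Thus we assume `|S| > λ^{1/2}/H`." This is
the SMALL-WEIGHT half of Theorem 1, and for the Liouville function it is now available in the tree:
B. Green's Proposition 1 for `λ` is PROVED (`green_liouville_fourierWalsh_holds`,
`MoebiusWalshCircuitsFourierWalshProofs.lean`: `|λ̂ₙ(S)| ≤ K k e^{-c√n/k}`, `|S| = k ≥ 1`). We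
record the two consequences the assembly of `bourgain_liouville_walsh_uniform` consumes:

* `abs_walshSum_liouville_le_of_card_le` — for `S ≠ ∅` with `|S| ≤ √n/H` (`H > 0`):
  `|walshSum λ S| ≤ 2ⁿ · K (√n/H) e^{-cH}` (the function `k ↦ k e^{-c√n/k}` is increasing);
* `abs_walshSum_liouville_empty_le` — `|walshSum λ ∅| = |∑_{x<2ⁿ} λ(x)| ≤ 2ⁿ · 2K e^{-(c/2)√n}`,
  from Proposition 1 at the one-element digit sets `{0}`, `{n}` of level `n + 1`
  (`Green2012.liouville_walshSum_empty_le`; no prime number theorem is needed).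
Both with the SAME absolute constants `c > 0`, `K ≥ 0` (`liouville_smallWeight`).

## References

* J. Bourgain, J. Anal. Math. 119 (2013) 147–163, §2, (2.32); Theorem 1 (remark on λ).
  [Bourgain2013MoebiusWalsh]
* B. Green, Combin. Probab. Comput. 21 (2012) 942–951, Proposition 1 and §1 (remark on λ).
  [Green2012]
-/

noncomputable section

open Finset Real

namespace Literature.NumberTheory.LFunctions.LiouvilleWalsh

/-- `k ↦ k e^{-a/k}` is monotone on `k > 0` for `a ≥ 0`. [folklore] -/
theorem mul_exp_neg_div_mono {a k₁ k₂ : ℝ} (ha : 0 ≤ a) (hk₁ : 0 < k₁) (hk : k₁ ≤ k₂) :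
    k₁ * Real.exp (-(a / k₁)) ≤ k₂ * Real.exp (-(a / k₂)) := by
  have hk₂ : 0 < k₂ := lt_of_lt_of_le hk₁ hk
  refine mul_le_mul hk ?_ (Real.exp_pos _).le hk₂.le
  rw [Real.exp_le_exp, neg_le_neg_iff]
  exact div_le_div_of_nonneg_left ha hk₁ hk

/-- **Small weight, Liouville** (Bourgain (2.32) for `λ`, from Green's Proposition 1 for `λ`,
proved in the tree): there are absolute `c > 0`, `K ≥ 0` such that for all `n ≥ 1`, `H > 0` and
every nonempty `S ⊆ Fin n` with `|S| ≤ √n/H`,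
`|walshSum λ S| ≤ 2ⁿ · K (√n/H) e^{-cH}`; and `|walshSum λ ∅| ≤ 2ⁿ · 2K e^{-(c/2)√n}` for all `n`.
[cite: Bourgain2013MoebiusWalsh, (2.32) and Theorem 1 (remark on λ); Green2012, Proposition 1] -/
theorem liouville_smallWeight :
    ∃ c : ℝ, 0 < c ∧ ∃ K : ℝ, 0 ≤ K ∧
      (∀ n : ℕ, 1 ≤ n → ∀ H : ℝ, 0 < H → ∀ S : Finset (Fin n), S.Nonempty →
        (S.card : ℝ) ≤ Real.sqrt n / H →
          |walshSum (fun m => (ArithmeticFunction.liouville m : ℤ)) S| ≤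
            2 ^ n * (K * (Real.sqrt n / H) * Real.exp (-(c * H)))) ∧
      (∀ n : ℕ, |walshSum (fun m => (ArithmeticFunction.liouville m : ℤ)) (∅ : Finset (Fin n))| ≤
        2 ^ n * (2 * K * Real.exp (-(c / 2 * Real.sqrt n)))) := by
  obtain ⟨c, hc, K, hX⟩ := green_liouville_fourierWalsh_holds
  -- `K ≥ 0` is forced by the bound at any nonempty `S` (take `n = 1`, `S = {0}`)
  have hK : 0 ≤ K := by
    have h := hX 1 le_rfl ({0} : Finset (Fin 1)) (by simp)
    have h0 : 0 ≤ |walshSum (fun m => (ArithmeticFunction.liouville m : ℤ)) ({0} : Finset (Fin 1))| / 2 ^ 1 :=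
      by positivity
    have h1 := h0.trans h
    simp only [Finset.card_singleton, Nat.cast_one, mul_one] at h1
    have he : 0 < Real.exp (-(c * Real.sqrt ((1 : ℕ) : ℝ) / 1)) := Real.exp_pos _
    nlinarith
  refine ⟨c, hc, K, hK, ?_, ?_⟩
  · intro n hn H hH S hS hcard
    have h := hX n hn S hS
    rw [div_le_iff₀ (by positivity)] at h
    refine h.trans ?_
    rw [mul_comm _ ((2 : ℝ) ^ n)]
    refine mul_le_mul_of_nonneg_left ?_ (by positivity)
    have hk0 : (0 : ℝ) < S.card := by exact_mod_cast Finset.card_pos.2 hS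
    have hmono := mul_exp_neg_div_mono (a := c * Real.sqrt n)
      (mul_nonneg hc.le (Real.sqrt_nonneg _)) hk0 hcard
    have heq : c * Real.sqrt n / (Real.sqrt n / H) = c * H := by
      have hsq : 0 < Real.sqrt n := Real.sqrt_pos.2 (by exact_mod_cast hn)
      field_simp
    rw [heq] at hmono
    calc K * S.card * Real.exp (-(c * Real.sqrt n / S.card))
        = K * (S.card * Real.exp (-(c * Real.sqrt n / S.card))) := by ring
      _ ≤ K * (Real.sqrt n / H * Real.exp (-(c * H))) := mul_le_mul_of_nonneg_left hmono hK
      _ = K * (Real.sqrt n / H) * Real.exp (-(c * H)) := by ring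
  · intro n
    have h := Green2012.liouville_walshSum_empty_le hc.le hK hX n
    rw [div_le_iff₀ (by positivity)] at h
    linarith

/-- The nonempty small-weight bound alone. [cite: Bourgain2013MoebiusWalsh, (2.32)] -/
theorem abs_walshSum_liouville_le_of_card_le :
    ∃ c : ℝ, 0 < c ∧ ∃ K : ℝ, 0 ≤ K ∧
      ∀ n : ℕ, 1 ≤ n → ∀ H : ℝ, 0 < H → ∀ S : Finset (Fin n), S.Nonempty →
        (S.card : ℝ) ≤ Real.sqrt n / H →
          |walshSum (fun m => (ArithmeticFunction.liouville m : ℤ)) S| ≤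
            2 ^ n * (K * (Real.sqrt n / H) * Real.exp (-(c * H))) := by
  obtain ⟨c, hc, K, hK, h, -⟩ := liouville_smallWeight
  exact ⟨c, hc, K, hK, h⟩

/-- The empty digit set: `|∑_{x<2ⁿ} λ(x)| ≤ 2ⁿ · 2K e^{-(c/2)√n}`.
[cite: Green2012, Proposition 1 (remark on λ)] -/
theorem abs_walshSum_liouville_empty_le :
    ∃ c : ℝ, 0 < c ∧ ∃ K : ℝ, 0 ≤ K ∧
      ∀ n : ℕ, |walshSum (fun m => (ArithmeticFunction.liouville m : ℤ)) (∅ : Finset (Fin n))| ≤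
        2 ^ n * (2 * K * Real.exp (-(c / 2 * Real.sqrt n))) := by
  obtain ⟨c, hc, K, hK, -, h⟩ := liouville_smallWeight
  exact ⟨c, hc, K, hK, h⟩

end Literature.NumberTheory.LFunctions.LiouvilleWalsh
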